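import Summits.AtomisticToContinuum.BoseEinsteinCondensation.Theorems.BECCellInformationOneBodyEntropyBoundInsertionAssemblyBounds

/-!
# Crux `OneBodyEntropyBound` (stmt-AtomisticToContinuum-13440), line `registered`: stub `stub_insertionAssembly`

Route `BECCellInformation`, problem `BoseEinsteinCondensation` of the summit `AtomisticToContinuum`;
support file for the line's skeleton (namespace `…Cruxes.OneBodyEntropyBound.Birth`).

**Statement** (`stub_insertionAssembly`, the INSERTION LEMMA for a general repulsive finite-range
pair potential, hard cores allowed): given the Dirichlet bosonic floor, the Jastrow profile (J1),
the product Jastrow factor (J2) and the first variation at a near-minimiser (J3) as hypotheses,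
for every `κ > 0` there is `ρ₁ > 0` such that for `0 < ρ < ρ₁`, eventually in `n`,
`E₀(n+1, L) ≤ E₀(n, L) + κ` at `L = ((n+1)/ρ)^{1/3}`.

**Proof.** The new particle `x = X 0` is inserted with the one-body factor `θ(x − z)` (a dilated
one-particle Dirichlet bump, kinetic energy `< κ/16`) and DRESSED with `F(X) = ∏ⱼ f(x − X (j+1))`,
`f = 0` on the ball of radius `R₀ + 1 ⊇` range of `v`, so that it never interacts. With `Φ` a
`δ'`-near-minimiser of `E₀(n, L)`, the trial function `Ψ_z(X) = θ(x − z) F(X) Φ(X 1, …, X n)` is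
`C¹`, vanishes off `Λ_L^{n+1}` and (parts 1–2, `…InsertionAssemblySlices/Bounds`) has energy
`≤ E₀(n, L)‖Ψ_z‖² + 2·κ/16 + err + 9 w(z)`, where the bath energy of every slice `Z ↦ F(x,Z)Φ(Z)`
is controlled by J3 (`err ≤ κ/16` for `δ'` small) and `w(z) = ∫|θ(x − z)|² W₁(x) dx`. The floor
gives `E₀(n+1, L)‖Ψ_z‖² ≤ …`; averaging the position `z` over `[0, L/2)³` (`∫ w = n ∫(1 − f)`),
some `z` has `w(z) ≤ 8ρ ∫(1 − f) ≤ min(1, κ/16)/4`, whence `‖Ψ_z‖² ≥ 1/2` and cancelling the mass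
`E₀(n+1, L) ≤ E₀(n, L) + 2(3κ/16 + 9κ/64) ≤ E₀(n, L) + κ`.
-/

noncomputable section

namespace Summit.AtomisticToContinuum.BoseEinsteinCondensation.Cruxes.OneBodyEntropyBound.Birth

open MeasureTheory Filter Topology
open scoped ENNReal NNReal
open Literature.MathematicalPhysics.QuantumManyBody.BoseGas

namespace InsertionAssembly

variable {n : ℕ}

/-! ### The translated one-body factor -/

/-- The one-body mode `w ↦ Θ(w − z)` of a one-particle Dirichlet state `Θ` is `C¹`. [folklore] -/
theorem contDiff_translate {b : ℝ} (Θ : TrialState 1 b) (z : Space) :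
    ContDiff ℝ 1 fun w : Space => Θ.ψ (fun _ => w - z) :=
  Θ.contDiff.comp (contDiff_pi.2 fun _ => contDiff_id.sub contDiff_const)

/-- `∫ |Θ(x − z)|² dx = 1`. [folklore] -/
theorem lintegral_normSq_translate {b : ℝ} (Θ : TrialState 1 b) (z : Space) :
    ∫⁻ x : Space, (‖Θ.ψ (fun _ => x - z)‖₊ : ℝ≥0∞) ^ 2 = 1 := by
  have h := lintegral_sub_right_eq_self (μ := (volume : Measure Space))
    (fun y : Space => (‖Θ.ψ (fun _ => y)‖₊ : ℝ≥0∞) ^ 2) z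
  refine h.trans ?_
  rw [← lintegral_funUnique_comp (fun y : Space => (‖Θ.ψ (fun _ => y)‖₊ : ℝ≥0∞) ^ 2), ← Θ.norm_eq]
  exact lintegral_congr fun Y => congrArg (fun W : Config 1 => (‖Θ.ψ W‖₊ : ℝ≥0∞) ^ 2)
    (const_apply_zero_eq Y)

/-- `∫ |∇(Θ(· − z))|² ≤ 𝓔₀[Θ]` (the one-body gradient of the mode is the kinetic density of the
one-particle state; translation invariance). [folklore] -/
theorem lintegral_gradSqC_translate_le {b : ℝ} (Θ : TrialState 1 b) (z : Space) :
    ∫⁻ x : Space, gradSqC (fun w : Space => Θ.ψ (fun _ => w - z)) x ≤ energy 0 Θ := by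
  have hd : Differentiable ℝ Θ.ψ := Θ.contDiff.differentiable one_ne_zero
  have hA : ∀ x : Space, HasFDerivAt (fun w : Space => (fun _ : Fin 1 => w - z : Config 1))
      (ContinuousLinearMap.pi fun _ : Fin 1 => ContinuousLinearMap.id ℝ Space) x := fun x =>
    hasFDerivAt_pi.2 fun _ => (hasFDerivAt_id x).sub_const z
  have hgrad : ∀ x : Space, gradSqC (fun w : Space => Θ.ψ (fun _ => w - z)) x =
      kineticDensity Θ.ψ (fun _ => x - z) := by
    intro x
    unfold gradSqC kineticDensity
    rw [Fin.sum_univ_one]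
    refine Finset.sum_congr rfl fun k _ => ?_
    have h := ((hd _).hasFDerivAt.comp x (hA x)).fderiv
    have hCe : (ContinuousLinearMap.pi fun _ : Fin 1 => ContinuousLinearMap.id ℝ Space)
        (EuclideanSpace.single k (1 : ℝ)) = (Pi.single (0 : Fin 1) (EuclideanSpace.single k (1 : ℝ)) :
          Config 1) := by
      funext j
      rw [Subsingleton.elim j 0]
      simp
    rw [show (fun w : Space => Θ.ψ (fun _ => w - z)) = Θ.ψ ∘ fun w : Space =>
        (fun _ : Fin 1 => w - z : Config 1) from rfl, h, ContinuousLinearMap.comp_apply, hCe]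
  simp_rw [hgrad]
  have h := lintegral_sub_right_eq_self (μ := (volume : Measure Space))
    (fun y : Space => kineticDensity Θ.ψ (fun _ => y)) z
  refine (le_of_eq h).trans ?_
  rw [← lintegral_funUnique_comp (fun y : Space => kineticDensity Θ.ψ (fun _ => y))]
  calc ∫⁻ Y : Config 1, kineticDensity Θ.ψ (fun _ => Y 0) = ∫⁻ Y : Config 1, kineticDensity Θ.ψ Y :=
        lintegral_congr fun Y => congrArg (kineticDensity Θ.ψ) (const_apply_zero_eq Y)
    _ ≤ energy 0 Θ := lintegral_mono fun Y => le_self_add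

/-! ### Constants -/

/-- Choice of the slack `δ'`: the first-variation error `√(δ'(3(E + δ') + 18 n D²))` with `D = n`
is below any `κ > 0` for small `δ' > 0`. [folklore] -/
theorem exists_delta_small {E : ℝ} (hE : 0 ≤ E) (n : ℕ) {κ : ℝ} (hκ : 0 < κ) :
    ∃ d : ℝ, 0 < d ∧ Real.sqrt (d * (3 * (E + d) + 18 * n * (n : ℝ) ^ 2)) ≤ κ := by
  set A : ℝ := 3 * (E + 1) + 18 * n * (n : ℝ) ^ 2 + 1 with hA
  have hA0 : 0 < A := by positivity
  refine ⟨min 1 (κ ^ 2 / A), lt_min one_pos (by positivity), ?_⟩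
  rw [show κ = Real.sqrt (κ ^ 2) from (Real.sqrt_sq hκ.le).symm]
  rw [Real.sq_sqrt (sq_nonneg κ)]
  refine Real.sqrt_le_sqrt ?_
  have hd1 : min 1 (κ ^ 2 / A) ≤ 1 := min_le_left _ _
  have hd2 : min 1 (κ ^ 2 / A) * A ≤ κ ^ 2 := by
    rw [← le_div_iff₀ hA0]; exact min_le_right _ _
  have hd0 : 0 ≤ min 1 (κ ^ 2 / A) := le_min zero_le_one (by positivity)
  calc min 1 (κ ^ 2 / A) * (3 * (E + min 1 (κ ^ 2 / A)) + 18 * n * (n : ℝ) ^ 2)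
      ≤ min 1 (κ ^ 2 / A) * A := by
        refine mul_le_mul_of_nonneg_left ?_ hd0
        rw [hA]; nlinarith
    _ ≤ κ ^ 2 := hd2

/-- **Final step** (cancelling the mass): from `E₁ M ≤ E M + c + 9w`, `1 ≤ M + 2w`, `4w ≤ 1`
and `M ≤ 1`: `E₁ ≤ E + 2(c + 9w)`. [folklore] -/
theorem final_step {E₁ E M c w : ℝ≥0∞} (hfloor : E₁ * M ≤ E * M + c + 9 * w)
    (hlow : 1 ≤ M + 2 * w) (hw : 4 * w ≤ 1) (hM1 : M ≤ 1) : E₁ ≤ E + 2 * (c + 9 * w) := by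
  have h2M : 1 ≤ 2 * M := by
    have h : (1 : ℝ≥0∞) + 1 ≤ 2 * M + 1 :=
      calc (1 : ℝ≥0∞) + 1 = 2 * 1 := by rw [two_mul]
        _ ≤ 2 * (M + 2 * w) := mul_le_mul' le_rfl hlow
        _ = 2 * M + 4 * w := by ring
        _ ≤ 2 * M + 1 := add_le_add le_rfl hw
    exact (ENNReal.add_le_add_iff_right ENNReal.one_ne_top).1 h
  have hM0 : M ≠ 0 := by
    rintro rfl
    rw [mul_zero] at h2M
    exact absurd h2M (by simp)
  have hMtop : M ≠ ⊤ := ne_top_of_le_ne_top ENNReal.one_ne_top hM1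
  have key : E₁ * M ≤ (E + 2 * (c + 9 * w)) * M := by
    calc E₁ * M ≤ E * M + c + 9 * w := hfloor
      _ = E * M + (c + 9 * w) * 1 := by ring
      _ ≤ E * M + (c + 9 * w) * (2 * M) := add_le_add le_rfl (mul_le_mul' le_rfl h2M)
      _ = (E + 2 * (c + 9 * w)) * M := by ring
  exact (ENNReal.mul_le_mul_iff_left hM0 hMtop).1 key

/-- **One dressed insertion at position `z`.** Floor + energy bound + norm identities:
`E₀(n+1)M_z ≤ E₀(n)M_z + (2𝓔₀[Θ] + err) + 9w(z)`, `1 ≤ M_z + 2w(z)`, `M_z ≤ 1`. [folklore] -/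
theorem dressed_insertion_at {L b : ℝ} {v : ℝ → ℝ≥0∞} (hv : Measurable v)
    (hfloorN : ∀ g : Config (n + 1) → ℂ, ContDiff ℝ 1 g → (∀ X, X ∉ boxN (n + 1) L → g X = 0) →
      groundStateEnergy v (n + 1) L * ∫⁻ X, (‖g X‖₊ : ℝ≥0∞) ^ 2 ≤
        ∫⁻ X, (kineticDensity g X + interaction v X * (‖g X‖₊ : ℝ≥0∞) ^ 2))
    {f : Space → ℝ} (hfC : ContDiff ℝ 1 f) (hf01 : ∀ z, 0 ≤ f z ∧ f z ≤ 1)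
    {F : Config (n + 1) → ℝ} (hFC : ContDiff ℝ 1 F) (hF01 : ∀ X, 0 ≤ F X ∧ F X ≤ 1)
    (hF0 : ∀ (X : Config (n + 1)) (w : Space), ‖fderiv ℝ F X (Pi.single 0 w)‖ ≤ (1 - F X) * ‖w‖)
    (hFsum : ∀ X : Config (n + 1), 1 - F X ≤ ∑ j : Fin n, (1 - f (X 0 - X j.succ)))
    (Φ : TrialState n L) (Θ : TrialState 1 b) {z : Space}
    (hz : ∀ x : Space, x - z ∈ box b → x ∈ box L)
    (hcross : ∀ (x : Space) (Z : Config n) (j : Fin n),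
      v (dist x (Z j)) = 0 ∨ F (Matrix.vecCons x Z) = 0)
    (hG5 : ∀ (x : Space) (Z : Config n) (j : Fin n) (k : Fin 3),
      (fderiv ℝ (fun Z : Config n => F (Matrix.vecCons x Z)) Z
        (Pi.single j (EuclideanSpace.single k (1 : ℝ)))) ^ 2 ≤ 1 - f (x - Z j))
    {err : ℝ≥0∞}
    (hJ3 : ∀ x : Space,
      ∫⁻ Z, (kineticDensity (fun Z : Config n => (F (Matrix.vecCons x Z) : ℂ) * Φ.ψ Z) Z +
        interaction v Z * (‖(F (Matrix.vecCons x Z) : ℂ) * Φ.ψ Z‖₊ : ℝ≥0∞) ^ 2) ≤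
      groundStateEnergy v n L *
          (∫⁻ Z, ENNReal.ofReal (F (Matrix.vecCons x Z) ^ 2) * (‖Φ.ψ Z‖₊ : ℝ≥0∞) ^ 2) +
        (∫⁻ Z, (∑ j : Fin n, ∑ k : Fin 3, ENNReal.ofReal
          ((fderiv ℝ (fun Z : Config n => F (Matrix.vecCons x Z)) Z
            (Pi.single j (EuclideanSpace.single k (1 : ℝ)))) ^ 2)) * (‖Φ.ψ Z‖₊ : ℝ≥0∞) ^ 2) + err) :
    groundStateEnergy v (n + 1) L *
          (∫⁻ x, (‖Θ.ψ (fun _ => x - z)‖₊ : ℝ≥0∞) ^ 2 *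
            ∫⁻ Z, ENNReal.ofReal (F (Matrix.vecCons x Z) ^ 2) * (‖Φ.ψ Z‖₊ : ℝ≥0∞) ^ 2) ≤
        groundStateEnergy v n L *
            (∫⁻ x, (‖Θ.ψ (fun _ => x - z)‖₊ : ℝ≥0∞) ^ 2 *
              ∫⁻ Z, ENNReal.ofReal (F (Matrix.vecCons x Z) ^ 2) * (‖Φ.ψ Z‖₊ : ℝ≥0∞) ^ 2) +
          (2 * energy 0 Θ + err) +
          9 * ∫⁻ x, (‖Θ.ψ (fun _ => x - z)‖₊ : ℝ≥0∞) ^ 2 *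
            ∫⁻ Z, (∑ j : Fin n, ENNReal.ofReal (1 - f (x - Z j))) * (‖Φ.ψ Z‖₊ : ℝ≥0∞) ^ 2 ∧
      1 ≤ (∫⁻ x, (‖Θ.ψ (fun _ => x - z)‖₊ : ℝ≥0∞) ^ 2 *
            ∫⁻ Z, ENNReal.ofReal (F (Matrix.vecCons x Z) ^ 2) * (‖Φ.ψ Z‖₊ : ℝ≥0∞) ^ 2) +
        2 * ∫⁻ x, (‖Θ.ψ (fun _ => x - z)‖₊ : ℝ≥0∞) ^ 2 *
          ∫⁻ Z, (∑ j : Fin n, ENNReal.ofReal (1 - f (x - Z j))) * (‖Φ.ψ Z‖₊ : ℝ≥0∞) ^ 2 ∧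
      (∫⁻ x, (‖Θ.ψ (fun _ => x - z)‖₊ : ℝ≥0∞) ^ 2 *
          ∫⁻ Z, ENNReal.ofReal (F (Matrix.vecCons x Z) ^ 2) * (‖Φ.ψ Z‖₊ : ℝ≥0∞) ^ 2) ≤ 1 := by
  have hθ := contDiff_translate Θ z
  have hθ1 := lintegral_normSq_translate Θ z
  refine ⟨?_, one_le_mass_add hθ.continuous hθ1 hFC.continuous hF01 hfC.continuous hf01 hFsum
    Φ.contDiff.continuous Φ.norm_eq, mass_le_one hθ1 hF01 Φ.norm_eq⟩
  have hf := hfloorN _ (contDiff_dressed hθ hFC Φ.contDiff) (dressed_eq_zero Φ Θ F hz)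
  rw [lintegral_normSq_dressed hθ.continuous hFC.continuous Φ.contDiff.continuous] at hf
  refine hf.trans ((lintegral_energyDensity_dressed_le hθ hFC hF01 hF0 hfC.continuous hf01 hFsum
    Φ.contDiff Φ.norm_eq hv hcross hG5 hJ3).trans ?_)
  rw [hθ1, mul_one]
  refine add_le_add_three le_rfl (add_le_add ?_ le_rfl) le_rfl
  exact mul_le_mul' le_rfl (lintegral_gradSqC_translate_le Θ z)

end InsertionAssembly

open InsertionAssembly InsertionIntegrable in
/-- **Stub `stub_insertionAssembly` (insertion lemma, general repulsive finite-range `v`).** Given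
the Dirichlet bosonic floor, the Jastrow profile, the product Jastrow factor and the first variation
at a near-minimiser, adding one particle to the Dirichlet box costs at most `κ`, `κ → 0` with the
density: `E₀(n+1, L) ≤ E₀(n, L) + κ` at `L = ((n+1)/ρ)^{1/3}`, eventually in `n`, for `ρ < ρ₁(κ, v)`.
[cite: LSSY2005, Thm 2.2 / (2.17)–(2.26) (Dyson's upper bound)] -/
theorem stub_insertionAssembly :
    (∀ (N : ℕ) (L : ℝ) (v : ℝ → ENNReal), Measurable v →
      ∀ f : Literature.MathematicalPhysics.QuantumManyBody.BoseGas.Config N → ℂ, ContDiff ℝ 1 f →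
        (∀ X, X ∉ Literature.MathematicalPhysics.QuantumManyBody.BoseGas.boxN N L → f X = 0) →
        Literature.MathematicalPhysics.QuantumManyBody.BoseGas.groundStateEnergy v N L *
            ∫⁻ X, (‖f X‖₊ : ENNReal) ^ 2 ≤
          ∫⁻ X, (Literature.MathematicalPhysics.QuantumManyBody.BoseGas.kineticDensity f X +
            Literature.MathematicalPhysics.QuantumManyBody.BoseGas.interaction v X * (‖f X‖₊ : ENNReal) ^ 2)) →
    (∀ R₁ : ℝ, 0 < R₁ → ∃ f : EuclideanSpace ℝ (Fin 3) → ℝ,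
      ContDiff ℝ 1 f ∧ (∀ z, 0 ≤ f z ∧ f z ≤ 1) ∧ (∀ z, ‖z‖ ≤ R₁ → f z = 0) ∧
      (∀ z, ‖fderiv ℝ f z‖ ≤ 1 - f z) ∧ (∀ z, f (-z) = f z) ∧
      (∫⁻ z, ENNReal.ofReal (1 - f z)) ≠ ⊤) →
    (∀ f : EuclideanSpace ℝ (Fin 3) → ℝ, ContDiff ℝ 1 f → (∀ z, 0 ≤ f z ∧ f z ≤ 1) →
      (∀ z, ‖fderiv ℝ f z‖ ≤ 1 - f z) →
      ∀ n : ℕ,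
        ContDiff ℝ 1 (fun X : Literature.MathematicalPhysics.QuantumManyBody.BoseGas.Config (n + 1) =>
          ∏ j : Fin n, f (X 0 - X j.succ)) ∧
        ∀ X : Literature.MathematicalPhysics.QuantumManyBody.BoseGas.Config (n + 1),
          (0 ≤ ∏ j : Fin n, f (X 0 - X j.succ) ∧ ∏ j : Fin n, f (X 0 - X j.succ) ≤ 1) ∧
          (∀ w : EuclideanSpace ℝ (Fin 3),
            ‖fderiv ℝ (fun X : Literature.MathematicalPhysics.QuantumManyBody.BoseGas.Config (n + 1) =>
                ∏ j : Fin n, f (X 0 - X j.succ)) X (Pi.single 0 w)‖ ≤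
              (1 - ∏ j : Fin n, f (X 0 - X j.succ)) * ‖w‖) ∧
          (∀ (j : Fin n) (w : EuclideanSpace ℝ (Fin 3)),
            ‖fderiv ℝ (fun X : Literature.MathematicalPhysics.QuantumManyBody.BoseGas.Config (n + 1) =>
                ∏ j : Fin n, f (X 0 - X j.succ)) X (Pi.single j.succ w)‖ ≤
              (1 - f (X 0 - X j.succ)) * ‖w‖) ∧
          (1 - ∏ j : Fin n, f (X 0 - X j.succ) ≤ ∑ j : Fin n, (1 - f (X 0 - X j.succ)))) →
    (∀ (n : ℕ) (L : ℝ) (v : ℝ → ENNReal), Measurable v →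
      ∀ (Φ : Literature.MathematicalPhysics.QuantumManyBody.BoseGas.TrialState n L) (δ' : ENNReal), δ' ≠ ⊤ →
      Literature.MathematicalPhysics.QuantumManyBody.BoseGas.groundStateEnergy v n L ≠ ⊤ →
      Literature.MathematicalPhysics.QuantumManyBody.BoseGas.energy v Φ ≤
        Literature.MathematicalPhysics.QuantumManyBody.BoseGas.groundStateEnergy v n L + δ' →
      ∀ (G : Literature.MathematicalPhysics.QuantumManyBody.BoseGas.Config n → ℝ), ContDiff ℝ 1 G →
      (∀ X, 0 ≤ G X ∧ G X ≤ 1) →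
      (∀ (σ : Equiv.Perm (Fin n)) (X : Literature.MathematicalPhysics.QuantumManyBody.BoseGas.Config n),
        G (X ∘ σ) = G X) →
      ∀ (D : ℝ), (∀ X, ‖fderiv ℝ G X‖ ≤ D) →
      (∫⁻ X, (Literature.MathematicalPhysics.QuantumManyBody.BoseGas.kineticDensity
          (fun X : Literature.MathematicalPhysics.QuantumManyBody.BoseGas.Config n => (G X : ℂ) * Φ.ψ X) X +
        Literature.MathematicalPhysics.QuantumManyBody.BoseGas.interaction v X *
          (‖(G X : ℂ) * Φ.ψ X‖₊ : ENNReal) ^ 2)) ≤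
      Literature.MathematicalPhysics.QuantumManyBody.BoseGas.groundStateEnergy v n L *
          (∫⁻ X, ENNReal.ofReal (G X ^ 2) * (‖Φ.ψ X‖₊ : ENNReal) ^ 2) +
        (∫⁻ X, (∑ i : Fin n, ∑ k : Fin 3, ENNReal.ofReal
            ((fderiv ℝ G X (Pi.single i (EuclideanSpace.single k (1 : ℝ)))) ^ 2)) * (‖Φ.ψ X‖₊ : ENNReal) ^ 2) +
        ENNReal.ofReal (Real.sqrt (δ'.toReal *
          (3 * ((Literature.MathematicalPhysics.QuantumManyBody.BoseGas.groundStateEnergy v n L).toReal + δ'.toReal) +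
            18 * n * D ^ 2)))) →
    ∀ v : ℝ → ENNReal, Literature.MathematicalPhysics.QuantumManyBody.BoseGas.IsRepulsiveFiniteRange v →
      ∀ κ : ℝ, 0 < κ → ∃ ρ₁ : ℝ, 0 < ρ₁ ∧ ∀ ρ : ℝ, 0 < ρ → ρ < ρ₁ →
        ∀ᶠ n : ℕ in Filter.atTop,
          Literature.MathematicalPhysics.QuantumManyBody.BoseGas.groundStateEnergy v (n + 1)
              (Literature.MathematicalPhysics.QuantumManyBody.BoseGas.sideLength ρ (n + 1)) ≤
            Literature.MathematicalPhysics.QuantumManyBody.BoseGas.groundStateEnergy v n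
              (Literature.MathematicalPhysics.QuantumManyBody.BoseGas.sideLength ρ (n + 1)) + ENNReal.ofReal κ := by
  intro hfloor hJ1 hJ2 hJ3 v hv κ hκ
  -- the range of the potential and the Jastrow profile
  obtain ⟨R₀, hR₀⟩ := hv.2
  have hR₁ : (0 : ℝ) < max R₀ 0 + 1 := by positivity
  obtain ⟨f, hfC, hf01, hfR, hfD, -, hIg⟩ := hJ1 (max R₀ 0 + 1) hR₁
  set Ig : ℝ≥0∞ := ∫⁻ z : Space, ENNReal.ofReal (1 - f z) with hIgdef
  have hIgr : Ig = ENNReal.ofReal Ig.toReal := (ENNReal.ofReal_toReal hIg).symm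
  -- the one-body factor
  have hκ16 : 0 < κ / 16 := by positivity
  obtain ⟨b, hb, Θ, hΘ⟩ := exists_oneBody_smallEnergy hκ16
  -- the density threshold
  have hκ'0 : 0 < min 1 (κ / 16) := lt_min one_pos hκ16
  refine ⟨min 1 (κ / 16) / (32 * (Ig.toReal + 1)), by positivity, fun ρ hρ hρ₁ => ?_⟩
  have hL : ∀ᶠ m : ℕ in atTop, 2 * b ≤ sideLength ρ (m + 1) :=
    ((tendsto_sideLength_atTop hρ).comp (tendsto_add_atTop_nat 1)).eventually_ge_atTop (2 * b)
  filter_upwards [hL] with n hn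
  set L := sideLength ρ (n + 1) with hLdef
  have hL0 : 0 < L := by linarith
  have hbL : b ≤ L / 2 := by linarith
  have hL3 : L ^ 3 = ((n : ℝ) + 1) / ρ := by
    rw [hLdef, sideLength_pow_three hρ (n + 1)]
    push_cast
    rfl
  -- nothing to prove if `E₀(n, L) = ∞`
  rcases eq_or_ne (groundStateEnergy v n L) ⊤ with htop | htop
  · rw [htop, top_add]; exact le_top
  -- the product Jastrow factor for `n` bath particles
  obtain ⟨hFC, hFX⟩ := hJ2 f hfC hf01 hfD n
  set F : Config (n + 1) → ℝ := fun X => ∏ j : Fin n, f (X 0 - X j.succ) with hFdef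
  have hF01 : ∀ X, 0 ≤ F X ∧ F X ≤ 1 := fun X => (hFX X).1
  have hF0 : ∀ (X : Config (n + 1)) (w : Space),
      ‖fderiv ℝ F X (Pi.single 0 w)‖ ≤ (1 - F X) * ‖w‖ := fun X w => (hFX X).2.1 w
  have hFj : ∀ (X : Config (n + 1)) (j : Fin n) (w : Space),
      ‖fderiv ℝ F X (Pi.single j.succ w)‖ ≤ (1 - f (X 0 - X j.succ)) * ‖w‖ :=
    fun X j w => (hFX X).2.2.1 j w
  have hFsum : ∀ X : Config (n + 1), 1 - F X ≤ ∑ j : Fin n, (1 - f (X 0 - X j.succ)) :=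
    fun X => (hFX X).2.2.2
  have hFd : Differentiable ℝ F := hFC.differentiable one_ne_zero
  have hG5 := fun (x : Space) (Z : Config n) (j : Fin n) (k : Fin 3) =>
    sq_fderiv_sliceFactor_single_le hFd (fun z => (hf01 z).1) hFj x Z j k
  have hcross : ∀ (x : Space) (Z : Config n) (j : Fin n),
      v (dist x (Z j)) = 0 ∨ F (Matrix.vecCons x Z) = 0 := fun x Z j =>
    cross_or_factor_eq_zero (lt_of_le_of_lt (le_max_left R₀ 0) (lt_add_one _)) hR₀ hfR x Z j
  -- the slack `δ'` and the near-minimiser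
  obtain ⟨d, hd, hsqrt⟩ :=
    exists_delta_small (E := (groundStateEnergy v n L).toReal) ENNReal.toReal_nonneg n hκ16
  have hlt : groundStateEnergy v n L < groundStateEnergy v n L + ENNReal.ofReal d :=
    ENNReal.lt_add_right htop (ENNReal.ofReal_pos.2 hd).ne'
  obtain ⟨Φ, hΦ⟩ := iInf_lt_iff.mp hlt
  -- the first variation at every frozen position of the inserted particle (J3, `D = n`)
  have hJ3x : ∀ x : Space,
      ∫⁻ Z, (kineticDensity (fun Z : Config n => (F (Matrix.vecCons x Z) : ℂ) * Φ.ψ Z) Z +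
        interaction v Z * (‖(F (Matrix.vecCons x Z) : ℂ) * Φ.ψ Z‖₊ : ℝ≥0∞) ^ 2) ≤
      groundStateEnergy v n L *
          (∫⁻ Z, ENNReal.ofReal (F (Matrix.vecCons x Z) ^ 2) * (‖Φ.ψ Z‖₊ : ℝ≥0∞) ^ 2) +
        (∫⁻ Z, (∑ j : Fin n, ∑ k : Fin 3, ENNReal.ofReal
          ((fderiv ℝ (fun Z : Config n => F (Matrix.vecCons x Z)) Z
            (Pi.single j (EuclideanSpace.single k (1 : ℝ)))) ^ 2)) * (‖Φ.ψ Z‖₊ : ℝ≥0∞) ^ 2) +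
        ENNReal.ofReal (κ / 16) := by
    intro x
    have h := hJ3 n L v hv.1 Φ (ENNReal.ofReal d) ENNReal.ofReal_ne_top htop hΦ.le
      (fun Z : Config n => F (Matrix.vecCons x Z)) (hFC.comp (contDiff_vecCons_right x))
      (fun Z => hF01 _) (sliceFactor_symm f x) n
      (norm_fderiv_sliceFactor_le hFd (fun z => (hf01 z).1) hFj x)
    rw [ENNReal.toReal_ofReal hd.le] at h
    exact h.trans (add_le_add le_rfl (ENNReal.ofReal_le_ofReal hsqrt))
  -- the position average of the weight
  have hθc : Continuous fun y : Space => Θ.ψ (fun _ => y) :=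
    Θ.contDiff.continuous.comp (continuous_pi fun _ => continuous_id)
  have hθ1 : ∫⁻ y : Space, (‖Θ.ψ (fun _ => y)‖₊ : ℝ≥0∞) ^ 2 = 1 := by
    simpa only [sub_zero] using lintegral_normSq_translate Θ 0
  have hmW := measurable_W₁ (n := n) hfC.continuous Φ.contDiff.continuous
  set w : Space → ℝ≥0∞ := fun z => ∫⁻ x, (‖Θ.ψ (fun _ => x - z)‖₊ : ℝ≥0∞) ^ 2 *
    ∫⁻ Z : Config n, (∑ j : Fin n, ENNReal.ofReal (1 - f (x - Z j))) * (‖Φ.ψ Z‖₊ : ℝ≥0∞) ^ 2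
    with hwdef
  have hmeas : Measurable w := measurable_lintegral_translate_mul hθc hmW
  have havg : ∫⁻ z, w z = n * Ig := by
    rw [hwdef, insertionAssembly_translate_average hθc hθ1 hmW,
      lintegral_W₁ hfC.continuous Φ.contDiff.continuous Φ.norm_eq]
  have hvol : volume (cell (L / 2)) = ENNReal.ofReal ((L / 2) ^ 3) := by
    rw [volume_cell, ENNReal.ofReal_pow (by positivity)]
  have hZ0 : volume (cell (L / 2)) ≠ 0 := by
    rw [hvol]; exact (ENNReal.ofReal_pos.2 (by positivity)).ne'
  have hZtop : volume (cell (L / 2)) ≠ ⊤ := by rw [hvol]; exact ENNReal.ofReal_ne_top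
  obtain ⟨z, hz, hzle⟩ := exists_le_setLAverage hZ0 hZtop hmeas.aemeasurable.restrict
  have hwz : w z ≤ ENNReal.ofReal (min 1 (κ / 16) / 4) := by
    refine hzle.trans ?_
    rw [setLAverage_eq]
    calc (∫⁻ a in cell (L / 2), w a) / volume (cell (L / 2))
        ≤ (n * Ig) / volume (cell (L / 2)) :=
          ENNReal.div_le_div_right ((setLIntegral_le_lintegral _ _).trans havg.le) _
      _ = ENNReal.ofReal ((n : ℝ) * Ig.toReal / (L / 2) ^ 3) := by
          rw [hvol, hIgr, ENNReal.toReal_ofReal ENNReal.toReal_nonneg, ← ENNReal.ofReal_natCast,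
            ← ENNReal.ofReal_mul (Nat.cast_nonneg n), ENNReal.ofReal_div_of_pos (by positivity)]
      _ ≤ ENNReal.ofReal (min 1 (κ / 16) / 4) :=
          ENNReal.ofReal_le_ofReal (density_bound ENNReal.toReal_nonneg hρ hρ₁ hL3 hL0)
  -- one dressed insertion at the good position
  obtain ⟨hins, hlow, hM1⟩ := dressed_insertion_at hv.1 (hfloor (n + 1) L v hv.1) hfC hf01 hFC hF01
    hF0 hFsum Φ Θ (fun x hx => mem_box_of_sub_mem_box hbL hz hx) hcross hG5 hJ3x
  have h4w : 4 * w z ≤ 1 := by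
    calc 4 * w z ≤ 4 * ENNReal.ofReal (min 1 (κ / 16) / 4) := mul_le_mul' le_rfl hwz
      _ = ENNReal.ofReal (4 * (min 1 (κ / 16) / 4)) := by
          rw [ENNReal.ofReal_mul (by norm_num), ENNReal.ofReal_ofNat]
      _ ≤ ENNReal.ofReal 1 := ENNReal.ofReal_le_ofReal (by linarith [min_le_left 1 (κ / 16)])
      _ = 1 := ENNReal.ofReal_one
  have hfin := final_step hins hlow h4w hM1
  refine hfin.trans (add_le_add le_rfl ?_)
  -- bookkeeping of the constants: `2(2·κ/16 + κ/16 + 9·κ/64) ≤ κ`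
  have hw64 : w z ≤ ENNReal.ofReal (κ / 64) :=
    hwz.trans (ENNReal.ofReal_le_ofReal (by linarith [min_le_right 1 (κ / 16)]))
  calc 2 * (2 * energy 0 Θ + ENNReal.ofReal (κ / 16) + 9 * w z)
      ≤ 2 * (2 * ENNReal.ofReal (κ / 16) + ENNReal.ofReal (κ / 16) + 9 * ENNReal.ofReal (κ / 64)) := by
        gcongr
    _ = ENNReal.ofReal (2 * (2 * (κ / 16) + κ / 16 + 9 * (κ / 64))) := by
        rw [ENNReal.ofReal_mul (by norm_num), ENNReal.ofReal_add (by positivity) (by positivity),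
          ENNReal.ofReal_add (by positivity) (by positivity), ENNReal.ofReal_mul (by norm_num),
          ENNReal.ofReal_mul (by norm_num), ENNReal.ofReal_ofNat, ENNReal.ofReal_ofNat]
    _ ≤ ENNReal.ofReal κ := ENNReal.ofReal_le_ofReal (by linarith)

end Summit.AtomisticToContinuum.BoseEinsteinCondensation.Cruxes.OneBodyEntropyBound.Birth

end
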